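import Summits.ResolutionOfSingularities.ResolutionOfSingularities.Theorems.WildConesCampaignW46HypersurfacesCharTwoTangentLeaf
import Summits.ResolutionOfSingularities.ResolutionOfSingularities.Theorems.WildConesCampaignW46HypersurfacesCharTwoEmbDimDynamics

/-!
# [OURS · L1 W4.6, rung (ii) at p = 2, EVERY dimension n] THE TANGENT CONE AT `e = 2`: the descent
# along the hyperbolic pairs and the state-level theorems — `h₂ = 3` ⇒ every double successor is
# NON-isolated; `h₂ = 1` ⇒ every double successor has `e = 0`, `μ = 1` and is resolved by the next
# blow-up (hypersurface double points `z² = a(u₁,…,uₙ)`, every field of characteristic 2)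

HONEST FRAMING. Everything here is OURS: theorems about route WildCones' own TYPED point-blow-up
dynamics (`Theorems/WildConesClassicalRegimesDefs.lean`: states `c : (Fin n → ℕ) → κ` = coefficients of
`a(u₁,…,uₙ)` in `z² = a`; `step i τ c` = blow up the point, chart `u_i`, translate by `τ`, delete
squares; `MultP` = cleaned order `≥ 2` (a double point), `Isol` = finite Milnor algebra `κ⟦u⟧/(∂a)`,
`mu` = its dimension) with the invariants `milnorEmbDim = e` (p498937, embedding dimension of the
Milnor algebra = corank of the polar form) and `milnorHilbertTwo = h₂` (p511581, `dim_κ 𝔪_A²/𝔪_A³`).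
Nothing here is a statement of H. Hironaka's manuscript [Hironaka2017] and nothing of it is used; no
FACT-LIST premise. AI review is weaker than expert review. Cell res-hironaka (LADDER-RESOLUTION rung L,
D-0089), slot W4.6 «restricted regimes as rungs», seat res-L1-s46-pv-4 (gen 4): «(ii) THREEFOLD
HYPERSURFACES, second prover: the p = 2 hyperbolic-splitting regime of `ClassicalRegimes` (n ≥ 3,
order-2 cleaned states)». Host route `WildCones`, crux `ClassicalRegimes`
(stmt-ResolutionOfSingularities-16884, proved); `--supports` that item as a helper.

THE QUESTION LEFT OPEN BY GEN 3. `hypersurface_trichotomy` (p501990): for an isolated double state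
whose point-blow-up successor is a double point, `e ≤ 1` ⇒ successor isolated, `e ≥ 3` ⇒ not, and
`e = 2` undecided (both happen in `n = 4`, p507619: `u₀u₁ + u₂²u₃ + u₂u₃²` isolated successor,
`u₀u₁ + u₂⁵ + u₃⁵` non-isolated successor). THIS FILE decides the two extreme values of the next
invariant `h₂ ∈ {1, 2, 3}` (`milnorHilbertTwo_range`, p512443):

* `formal_tangent_cone` — the descent (strong induction on `n` along the tree's `exists_pair_ne` /
  `descent_step`, invariance of `jetTwoColength` AND `jetThreeColength` under the `κ`-isomorphisms of
  Milnor algebras) to the surface leaf `n = 2` (no `xy`-term), where `…TangentLeaf.lean` decides: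
  `jetThreeColength a = 6` ⇒ the Milnor algebra of `G` is not finite; `jetThreeColength a ≤ 4` ⇒
  `jetTwoColength G = 1`.
* `hypersurface_not_isol_step_of_milnorHilbertTwo_eq_three` — **`e = 2`, `h₂ = 3` (residual plane germ
  of order `≥ 4` modulo squares: NO tangent cubic) ⇒ every double successor is NON-isolated** (the
  state's own isolatedness is not needed). This is the class of p507619's second witness.
* `hypersurface_regime_step_of_milnorHilbertTwo_eq_one` — **`e = 2`, `h₂ = 1` (tangent cubic with
  THREE DISTINCT roots, the `D₄` configuration) ⇒ every double successor has `e = 0`, is isolated with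
  `μ = 1`, and has NO double point among ITS successors**: a second terminating regime, resolved within
  two blow-ups along every branch (`hypersurface_exit_le_two_of_milnorHilbertTwo_eq_one`). This is the
  class of p507619's first witness.
* The middle value `h₂ = 2` (tangent cubic with a multiple root) is decided for ISOLATED states in the
  companion `…HypersurfacesCharTwoIsolTransfer.lean` (every double successor of an isolated double
  state with `e = 2`, `h₂ ≤ 2` IS isolated), completing the dichotomy; `h₂ = 2` is not a closed class.

References: G.-M. Greuel, G. Pfister, The splitting lemma in any characteristic, J. Algebra 689 (2026)
= arXiv:2507.17078, Thm 3.5 / Cor 3.7 [GreuelPfister2026] (through the tree's `pair_reduction`,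
`descent_step`); H. Hironaka, ms. 2017-03-23 [Hironaka2017], Th. 16.6 p.84, Th. 16.13 p.87 — quoted
for the ROLE replaced only, under adjudication, not cited as fact.
-/

noncomputable section

-- single-problem summit: the doubled namespace component `ResolutionOfSingularities` is forced
set_option linter.dupNamespace false

open scoped BigOperators Classical

open MvPowerSeries IsLocalRing

open Literature.AlgebraicGeometry.Resolution

namespace Summit.ResolutionOfSingularities.ResolutionOfSingularities.Theorems

namespace CampaignW46.HypersurfacesCharTwo

open WildCones WildCones.MuDropCharTwoOrdP ThreefoldsCharTwo

variable {κ : Type} [Field κ]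

/-! ## A hyperbolic pair in a series without linear terms -/

/-- The constant term does not change the gradient ideal: `jetTwoColength (G - C c) = jetTwoColength G`.
[folklore] -/
theorem jetTwoColength_sub_C {n : ℕ} (G : MvPowerSeries (Fin n) κ) (c : κ) :
    jetTwoColength (G - C c) = jetTwoColength G := by
  have hfun : (fun s => MvPowerSeries.pderiv s (G - C c)) = fun s => MvPowerSeries.pderiv s G := by
    funext s
    rw [map_sub, pderiv_C, sub_zero]
  unfold jetTwoColength
  rw [hfun]

/-- A series without linear terms, minus its constant term, has order `≥ 2`. [folklore] -/
theorem two_le_order_sub_C {n : ℕ} {G : MvPowerSeries (Fin n) κ}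
    (hG0 : ∀ s, coeff (Finsupp.single s 1) G = 0) : 2 ≤ (G - C (constantCoeff G)).order := by
  rw [FormalCoordChange.two_le_order_iff]
  refine ⟨by rw [map_sub, constantCoeff_C, sub_self], fun s => ?_⟩
  rw [map_sub, hG0 s, coeff_C, if_neg (Finsupp.single_ne_zero.mpr one_ne_zero), sub_zero]

/-- [OURS · L1 W4.6] A series `G` without linear terms has `1 ≤ jetTwoColength G`; if moreover it has
a square-free quadratic monomial then `jetTwoColength G + 2 ≤ n + 1` (embedding dimension `≤ n - 2`).
Its constant term is irrelevant (`∂(G - G(0)) = ∂G`). [folklore] -/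
theorem jetTwoColength_add_two_le_of_pair [CharP κ 2] {n : ℕ} {G : MvPowerSeries (Fin n) κ}
    (hG0 : ∀ s, coeff (Finsupp.single s 1) G = 0) :
    1 ≤ jetTwoColength G ∧ ∀ {j l : Fin n}, j ≠ l →
      coeff (Finsupp.single j 1 + Finsupp.single l 1) G ≠ 0 → jetTwoColength G + 2 ≤ n + 1 := by
  have hord := two_le_order_sub_C hG0
  rw [← jetTwoColength_sub_C G (constantCoeff G)]
  refine ⟨(jetTwoColength_range hord).1, fun {j l} hjl hq => ?_⟩
  have hq' : coeff (Finsupp.single j 1 + Finsupp.single l 1) (G - C (constantCoeff G)) ≠ 0 := by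
    rw [map_sub, coeff_C, if_neg, sub_zero]
    · exact hq
    · intro h
      have := DFunLike.congr_fun h j
      rw [Finsupp.add_apply, Finsupp.single_eq_same, Finsupp.single_eq_of_ne hjl,
        Finsupp.coe_zero, Pi.zero_apply] at this
      omega
  exact (exists_pair_iff_jetTwoColength hord).mp ⟨j, l, hjl, hq'⟩

/-! ## The descent: the formal tangent-cone theorem -/

/-- [OURS · L1 W4.6] **THE FORMAL TANGENT-CONE THEOREM** (characteristic two, every `n`). Let
`X_i² G = a∘Φ_{i,τ}` be the blow-up relation (`ord a ≥ 2`, `G` without linear terms — the successor is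
again a double point) and let `a` have embedding dimension two (`jetTwoColength a = 3`: exactly one
non-hyperbolic plane after splitting the hyperbolic pairs). (1) If `jetThreeColength a = 6`
(`h₂ = 3`: the residual plane germ has no tangent cubic) then the Milnor algebra of `G` is NOT finite.
(2) If `jetThreeColength a ≤ 4` (`h₂ = 1`: three distinct tangents) then `jetTwoColength G = 1`
(embedding dimension zero: `G` is a hyperbolic pair plus higher terms, `μ(G) = 1`). Strong induction on
`n` along the tree's `descent_step` (a hyperbolic pair away from the chart index, `exists_pair_ne`) with
the invariance of both jet colengths; the leaf `n = 2` is `…TangentLeaf.lean`.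
[cite: GreuelPfister2026, Thm 3.5 and Cor 3.7] -/
theorem formal_tangent_cone [CharP κ 2] : ∀ (n : ℕ) (i : Fin n) (τ : Fin n → κ)
    (a G : MvPowerSeries (Fin n) κ), 2 ≤ a.order → (∀ s, coeff (Finsupp.single s 1) G = 0) →
    X i ^ 2 * G = subst (fun s => if s = i then (X i : MvPowerSeries (Fin n) κ)
      else X i * (X s + C (τ s))) a → jetTwoColength a = 3 →
    (jetThreeColength a = 6 →
      ¬ Module.Finite κ (MvPowerSeries (Fin n) κ ⧸
        Ideal.span (Set.range fun s => MvPowerSeries.pderiv s G))) ∧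
    (jetThreeColength a ≤ 4 → jetTwoColength G = 1) := by
  intro n
  induction n using Nat.strong_induction_on with
  | _ n ih =>
  intro i τ a G ha hG0 hG h3
  by_cases hpair : ∃ j l : Fin n, j ≠ l ∧ coeff (Finsupp.single j 1 + Finsupp.single l 1) a ≠ 0
  · obtain ⟨j, l, hjl, hj, hl, hq⟩ := exists_pair_ne i τ ha hG hG0 hpair
    obtain ⟨e, i', he, hi', -⟩ := exists_compl_embedding hjl (Ne.symm hj) (Ne.symm hl)
    obtain ⟨a', G', ha', hG0', hG', ⟨εa⟩, ⟨εG⟩⟩ :=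
      descent_step i τ ha hG0 hG hjl hj hl hq e he i' hi'
    have hlt : n - 2 < n := by
      have := Fin.pos i
      omega
    have h2a : jetTwoColength a = jetTwoColength a' := jetTwoColength_eq_of_equiv εa
    have h3a : jetThreeColength a = jetThreeColength a' := jetThreeColength_eq_of_equiv εa
    have h2G : jetTwoColength G = jetTwoColength G' := jetTwoColength_eq_of_equiv εG
    obtain ⟨k1, k2⟩ := ih (n - 2) hlt i' (fun t => τ (e t)) a' G' ha' hG0' hG' (by rw [← h2a, h3])
    refine ⟨fun h6 hfG => ?_, fun h4 => ?_⟩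
    · haveI := hfG
      exact k1 (by rw [← h3a, h6]) (Module.Finite.equiv εG.toLinearEquiv)
    · rw [h2G]
      exact k2 (by rw [← h3a]; exact h4)
  · push Not at hpair
    have ha' := (FormalCoordChange.two_le_order_iff a).mp ha
    have hcol : jetTwoColength a = n + 1 := jetTwoColength_of_no_pair ha'.2 hpair
    have hn : n = 2 := by omega
    subst hn
    have hj : ∃ j : Fin 2, j ≠ i := by
      fin_cases i
      · exact ⟨1, by decide⟩
      · exact ⟨0, by decide⟩
    obtain ⟨j, hji⟩ := hj
    refine ⟨fun h6 => not_finite_strict_of_pderiv_mem_cube le_rfl i τ hG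
      ((jetThreeColength_eq_six_iff a).mp h6), fun h4 => ?_⟩
    have hq := coeff_pair_strict_ne_zero_of_jetThreeColength_le_four hji τ ha hpair hG0 hG h4
    obtain ⟨h1, h2⟩ := jetTwoColength_add_two_le_of_pair hG0
    have hle := h2 hji.symm hq
    omega

/-! ## States: the two extreme values of `h₂` at `e = 2` -/

section States

variable {n : ℕ}

/-- [OURS · L1 W4.6 rung (ii) at `p = 2`, every dimension; NOT a statement of the manuscript]
**`e = 2`, `h₂ = 3`: EVERY DOUBLE SUCCESSOR IS NON-ISOLATED** (hypersurface double points
`z² = a(u₁,…,uₙ)`, any field of characteristic `2`, any `n`): if a double state has embedding dimension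
`e(c) = 2` (polar form of corank two) and `h₂(c) = 3` (the residual plane germ has order `≥ 4` modulo
squares — no tangent cubic), and its point-blow-up successor (chart `i`, translation `τ`) is again a
double point, then the successor is NOT an isolated singularity: such states leave the forced regime
only through non-isolated double points (like `e ≥ 3`, gen 3's
`hypersurface_not_isol_step_of_three_le`). The state's own isolatedness is not needed. Kernel witness of
the class: `z² = u₀u₁ + u₂⁵ + u₃⁵` (p507619, p485483). [folklore] -/
theorem hypersurface_not_isol_step_of_milnorHilbertTwo_eq_three [CharP κ 2] (c : (Fin n → ℕ) → κ)
    (i : Fin n) (τ : Fin n → κ) (hM : MultP 2 n κ c) (he : milnorEmbDim 2 n κ c = 2)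
    (hh : milnorHilbertTwo 2 n κ c = 3) (hM' : MultP 2 n κ (step 2 n κ i τ c)) :
    ¬ Isol 2 n κ (step 2 n κ i τ c) := by
  obtain ⟨G, ha, hG0, hG, -, hj'⟩ := dictCharTwo c i τ hM hM'
  have hcol := (milnorEmbDim_le_and_mod_two hM).2.2
  have hr := milnorHilbertTwo_range hM he
  obtain ⟨k1, -⟩ := formal_tangent_cone n i τ (ser 2 n κ c) G ha hG0 hG (by rw [hcol, he])
  change ¬ Module.Finite κ (MvPowerSeries (Fin n) κ ⧸ jac 2 n κ (step 2 n κ i τ c))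
  rw [hj']
  exact k1 (by rw [hr.2.2, hh])

/-- [OURS · L1 W4.6 rung (ii) at `p = 2`, every dimension; NOT a statement of the manuscript]
**`e = 2`, `h₂ = 1` (THREE DISTINCT TANGENTS): EVERY DOUBLE SUCCESSOR HAS `e = 0`, IS ISOLATED WITH
`μ = 1`** (hypersurface double points `z² = a(u₁,…,uₙ)`, any field of characteristic `2`, any `n`): if a
double state has `e(c) = 2` and `h₂(c) = 1` (the two Jacobian quadratic forms of the residual plane
cubic are independent — its tangent cone is three distinct lines, the `D₄` configuration) and its
point-blow-up successor is a double point, then the successor has a NON-DEGENERATE polar form: `e = 0`,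
hence it is isolated with Milnor number `1` (gen 3's `milnorEmbDim_eq_zero_iff`). The state's own
isolatedness is not needed (it follows: see the companion files). Kernel witness of the class:
`z² = u₀u₁ + u₂²u₃ + u₂u₃²` (p507619). [folklore] -/
theorem hypersurface_regime_step_of_milnorHilbertTwo_eq_one [CharP κ 2] (c : (Fin n → ℕ) → κ)
    (i : Fin n) (τ : Fin n → κ) (hM : MultP 2 n κ c) (he : milnorEmbDim 2 n κ c = 2)
    (hh : milnorHilbertTwo 2 n κ c = 1) (hM' : MultP 2 n κ (step 2 n κ i τ c)) :
    milnorEmbDim 2 n κ (step 2 n κ i τ c) = 0 ∧ Isol 2 n κ (step 2 n κ i τ c) ∧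
      mu 2 n κ (step 2 n κ i τ c) = 1 := by
  obtain ⟨G, ha, hG0, hG, -, hj'⟩ := dictCharTwo c i τ hM hM'
  have hcol := (milnorEmbDim_le_and_mod_two hM).2.2
  have hr := milnorHilbertTwo_range hM he
  obtain ⟨-, k2⟩ := formal_tangent_cone n i τ (ser 2 n κ c) G ha hG0 hG (by rw [hcol, he])
  have h1 : jetTwoColength G = 1 := k2 (by rw [hr.2.2, hh])
  have he' : milnorEmbDim 2 n κ (step 2 n κ i τ c) = 0 := by
    unfold milnorEmbDim
    rw [jetTwoColength_ser_eq_of_jac_eq hj', h1]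
  exact ⟨he', (milnorEmbDim_eq_zero_iff hM').mp he'⟩

/-- [OURS · L1 W4.6 rung (ii) at `p = 2`, every dimension; NOT a statement of the manuscript]
**`e = 2`, `h₂ = 1`: NO DOUBLE POINT TWO BLOW-UPS LATER** — the successor's successors (any chart, any
translation) all have multiplicity `< 2`. [folklore] -/
theorem hypersurface_not_multP_step_step_of_milnorHilbertTwo_eq_one [CharP κ 2]
    (c : (Fin n → ℕ) → κ) (i : Fin n) (τ : Fin n → κ) (hM : MultP 2 n κ c)
    (he : milnorEmbDim 2 n κ c = 2) (hh : milnorHilbertTwo 2 n κ c = 1)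
    (hM' : MultP 2 n κ (step 2 n κ i τ c)) (i' : Fin n) (τ' : Fin n → κ) :
    ¬ MultP 2 n κ (step 2 n κ i' τ' (step 2 n κ i τ c)) :=
  hypersurface_not_multP_step_of_milnorEmbDim_eq_zero _ hM'
    (hypersurface_regime_step_of_milnorHilbertTwo_eq_one c i τ hM he hh hM').1 i' τ'

/-- [OURS · L1 W4.6 rung (ii) at `p = 2`, every dimension; NOT a statement of the manuscript]
**`e = 2`, `h₂ = 1`: RESOLVED WITHIN TWO BLOW-UPS ALONG EVERY BRANCH** — from a double state with
`e(c₀) = 2`, `h₂(c₀) = 1`, along ANY chart word and ANY translation word the state at index `1` or the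
state at index `2` is NOT a double point. [folklore] -/
theorem hypersurface_exit_le_two_of_milnorHilbertTwo_eq_one [CharP κ 2] (c₀ : (Fin n → ℕ) → κ)
    (i : ℕ → Fin n) (t : ℕ → Fin n → κ) (hM : MultP 2 n κ c₀) (he : milnorEmbDim 2 n κ c₀ = 2)
    (hh : milnorHilbertTwo 2 n κ c₀ = 1) :
    ∃ m, 1 ≤ m ∧ m ≤ 2 ∧ ¬ MultP 2 n κ (run 2 n κ c₀ i t m) := by
  by_cases h1 : MultP 2 n κ (run 2 n κ c₀ i t 1)
  · exact ⟨2, by norm_num, le_rfl,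
      hypersurface_not_multP_step_step_of_milnorHilbertTwo_eq_one c₀ (i 0) (t 0) hM he hh h1
        (i 1) (t 1)⟩
  · exact ⟨1, le_rfl, by norm_num, h1⟩

end States

end CampaignW46.HypersurfacesCharTwo

end Summit.ResolutionOfSingularities.ResolutionOfSingularities.Theorems

end
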